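/-
Copyright (c) 2026 the pub-hodgecm-mathlib formalisation cell (harness21).  Prover seat hodgecm-mathlib-K2E5-p16 (g6), Track B «K2-LIT»,
#184♮ = hLiu418 = `stmt-HodgeConjecture-24832`; S2-asm road (γ) ANCHOR PURE-TENSOR letter PART 2a `K2LiuJunctionCompactPairKType` (generic Konno–Konno
junction algebra): `toBig (kV (a, b), 1)` — the junction image of a maximal-compact element paired with `1` — is block diagonal in the big sign frame with
blocks `diag(a ⊗ 1_R, b ⊗ 1_S)` ∕ `diag(a ⊗ 1_S, b ⊗ 1_R)`, after any relabelling; hence it is `kV (A, B)` with `det B = det(a)^{|S|}·det(b)^{|R|}`.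
THEOREMS ONLY (no `def`, no `instance`, no notation, no `sorry`).
-/
import Literature.NumberTheory.Weil1964.ArchUnitaryWeilHalfCompactBlock   -- ★ `UForm.exists_eq_kV_of_toBlocks_eq_zero`
import Mathlib.LinearAlgebra.Matrix.Kronecker
import HarnessLib

/-!
# Crux `HLiu418`, anchor letter PART 2a: the junction image `toBig (kV (a, b), 1)` is in the maximal compact, with explicit block determinants

Cell `hodgecm-mathlib`, crux item hLiu418 = `stmt-HodgeConjecture-24832` (helper lane `--supports`, count-neutral).

Generic signatures `P Q R S`; ★ `toBig : Ginf P Q R S →* UForm ((P × R) ⊕ (Q × S)) ((P × S) ⊕ (Q × R))` (matrix `reindex dpEquiv dpEquiv (g_V ⊗ g_W)`), ★ `kV`.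
* `toBig_kV_one_apply_inl_inr ∕ _inr_inl` — the off-diagonal blocks of `toBig (kV (a,b), 1)` vanish;
* `toBig_kV_one_apply_inr_inr` — the mixed-sign block is `fromBlocks (a ⊗ 1_S) 0 0 (b ⊗ 1_R)` entrywise; `_inl_inl` the same-sign block;
* `det_toBlocks₂₂_relabel_toBig_kV_one` — after relabelling by `(eP, eQ)`: `det (·)₂₂ = det(a)^{|S|} · det(b)^{|R|}` (and `₁₁`: `det(a)^{|R|}·det(b)^{|S|}`);
* **`exists_kV_eq_relabel_toBig_kV_one`** — `relabel eP eQ (toBig (kV (a,b), 1)) = kV (A, B)` with those determinants.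
With ★ PART 1 `archUFormPi_tensorEmb` and ★ `placeDiag_kV` this supplies the `hk : placeDiag (archUFormPi k′) = kV (A, B)` of ★ J1 §4 for `k ∈ K_∞` (PART 2b).
References: [KonnoKonno2007, §3.1 (3.1), Lemma 5.2]; [MoeglinVignerasWaldspurger1987, Ch. 1 I.17]; [Folland1989, §4.2 (4.39)].
HONEST LABEL: HC_CM is proved only modulo the 7 printed citations (2 remaining named inputs: hLiu418 = stmt-HodgeConjecture-24832,
h413 = stmt-HodgeConjecture-24833) until rung 0 closes; count-neutral helper, closes no socket.
-/

set_option autoImplicit false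
set_option linter.dupNamespace false

noncomputable section

open scoped Matrix Kronecker
open Literature.RepresentationTheory.KonnoKonno2007 Literature.RepresentationTheory.KonnoKonno2007.RealDualPair
open Literature.NumberTheory.Weil1964 Literature.Analysis.SegalBargmann

namespace Summit.HodgeConjecture.HodgeConjecture.Cruxes.HLiu418.K2LiuJunctionCompactPairKType

variable {P Q R S : Type} [Fintype P] [DecidableEq P] [Fintype Q] [DecidableEq Q] [Fintype R] [DecidableEq R]
  [Fintype S] [DecidableEq S]
variable {α' β' : Type} [Fintype α'] [DecidableEq α'] [Fintype β'] [DecidableEq β']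

/-! ## §1  The entries of `toBig (kV (a, b), 1)` -/

/-- the matrix of `toBig (kV (a,b), 1)` at `(i, j)`: `(diag(a,b) ⊗ 1) (dpEquiv⁻¹ i) (dpEquiv⁻¹ j)`. [cite: KonnoKonno2007, §3.1 (3.1)] -/
theorem toBig_kV_one_apply (a : Matrix.unitaryGroup P ℂ) (b : Matrix.unitaryGroup Q ℂ) (i j : DPIdx P Q R S) :
    (((toBig P Q R S (UForm.kV P Q (a, b), 1) : UForm ((P × R) ⊕ (Q × S)) ((P × S) ⊕ (Q × R))) : GL (DPIdx P Q R S) ℂ) :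
        Matrix (DPIdx P Q R S) (DPIdx P Q R S) ℂ) i j =
      Matrix.fromBlocks (a : Matrix P P ℂ) 0 0 (b : Matrix Q Q ℂ) ((dpEquiv P Q R S).symm i).1 ((dpEquiv P Q R S).symm j).1 *
        (1 : Matrix (R ⊕ S) (R ⊕ S) ℂ) ((dpEquiv P Q R S).symm i).2 ((dpEquiv P Q R S).symm j).2 := by
  rw [coe_toBig]
  change (Matrix.reindex (dpEquiv P Q R S) (dpEquiv P Q R S)
    ((((UForm.kV P Q (a, b) : UForm P Q) : GL (P ⊕ Q) ℂ) : Matrix (P ⊕ Q) (P ⊕ Q) ℂ) ⊗ₖ (1 : Matrix (R ⊕ S) (R ⊕ S) ℂ))) i j = _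
  rw [Matrix.reindex_apply, Matrix.submatrix_apply, Matrix.kroneckerMap_apply, UForm.coe_kV]

/-- the `(same-sign, mixed)` block of `toBig (kV (a,b), 1)` vanishes. [cite: KonnoKonno2007, §3.1 (3.1)] -/
theorem toBig_kV_one_apply_inl_inr (a : Matrix.unitaryGroup P ℂ) (b : Matrix.unitaryGroup Q ℂ) (i : (P × R) ⊕ (Q × S)) (j : (P × S) ⊕ (Q × R)) :
    (((toBig P Q R S (UForm.kV P Q (a, b), 1) : UForm ((P × R) ⊕ (Q × S)) ((P × S) ⊕ (Q × R))) : GL (DPIdx P Q R S) ℂ) :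
        Matrix (DPIdx P Q R S) (DPIdx P Q R S) ℂ) (Sum.inl i) (Sum.inr j) = 0 := by
  rw [toBig_kV_one_apply]
  rcases i with ⟨p, r⟩ | ⟨q, s⟩ <;> rcases j with ⟨p', s'⟩ | ⟨q', r'⟩ <;> simp

/-- the `(mixed, same-sign)` block of `toBig (kV (a,b), 1)` vanishes. [cite: KonnoKonno2007, §3.1 (3.1)] -/
theorem toBig_kV_one_apply_inr_inl (a : Matrix.unitaryGroup P ℂ) (b : Matrix.unitaryGroup Q ℂ) (i : (P × S) ⊕ (Q × R)) (j : (P × R) ⊕ (Q × S)) :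
    (((toBig P Q R S (UForm.kV P Q (a, b), 1) : UForm ((P × R) ⊕ (Q × S)) ((P × S) ⊕ (Q × R))) : GL (DPIdx P Q R S) ℂ) :
        Matrix (DPIdx P Q R S) (DPIdx P Q R S) ℂ) (Sum.inr i) (Sum.inl j) = 0 := by
  rw [toBig_kV_one_apply]
  rcases i with ⟨p, s⟩ | ⟨q, r⟩ <;> rcases j with ⟨p', r'⟩ | ⟨q', s'⟩ <;> simp

/-- the mixed-sign block of `toBig (kV (a,b), 1)` is `diag(a ⊗ 1_S, b ⊗ 1_R)`. [cite: KonnoKonno2007, §3.1 (3.1), Lemma 5.2] -/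
theorem toBig_kV_one_apply_inr_inr (a : Matrix.unitaryGroup P ℂ) (b : Matrix.unitaryGroup Q ℂ) (i j : (P × S) ⊕ (Q × R)) :
    (((toBig P Q R S (UForm.kV P Q (a, b), 1) : UForm ((P × R) ⊕ (Q × S)) ((P × S) ⊕ (Q × R))) : GL (DPIdx P Q R S) ℂ) :
        Matrix (DPIdx P Q R S) (DPIdx P Q R S) ℂ) (Sum.inr i) (Sum.inr j) =
      Matrix.fromBlocks ((a : Matrix P P ℂ) ⊗ₖ (1 : Matrix S S ℂ)) 0 0 ((b : Matrix Q Q ℂ) ⊗ₖ (1 : Matrix R R ℂ)) i j := by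
  rw [toBig_kV_one_apply]
  rcases i with ⟨p, s⟩ | ⟨q, r⟩ <;> rcases j with ⟨p', s'⟩ | ⟨q', r'⟩ <;>
    simp [Matrix.one_apply, Matrix.kroneckerMap_apply]

/-- the same-sign block of `toBig (kV (a,b), 1)` is `diag(a ⊗ 1_R, b ⊗ 1_S)`. [cite: KonnoKonno2007, §3.1 (3.1), Lemma 5.2] -/
theorem toBig_kV_one_apply_inl_inl (a : Matrix.unitaryGroup P ℂ) (b : Matrix.unitaryGroup Q ℂ) (i j : (P × R) ⊕ (Q × S)) :
    (((toBig P Q R S (UForm.kV P Q (a, b), 1) : UForm ((P × R) ⊕ (Q × S)) ((P × S) ⊕ (Q × R))) : GL (DPIdx P Q R S) ℂ) :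
        Matrix (DPIdx P Q R S) (DPIdx P Q R S) ℂ) (Sum.inl i) (Sum.inl j) =
      Matrix.fromBlocks ((a : Matrix P P ℂ) ⊗ₖ (1 : Matrix R R ℂ)) 0 0 ((b : Matrix Q Q ℂ) ⊗ₖ (1 : Matrix S S ℂ)) i j := by
  rw [toBig_kV_one_apply]
  rcases i with ⟨p, r⟩ | ⟨q, s⟩ <;> rcases j with ⟨p', r'⟩ | ⟨q', s'⟩ <;>
    simp [Matrix.one_apply, Matrix.kroneckerMap_apply]

/-! ## §2  After relabelling: block diagonal with explicit block determinants -/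

/-- the relabelled junction image has vanishing `₁₂` block. [cite: KonnoKonno2007, §3.1 (3.1)] -/
theorem toBlocks₁₂_relabel_toBig_kV_one (a : Matrix.unitaryGroup P ℂ) (b : Matrix.unitaryGroup Q ℂ)
    (eP : (P × R) ⊕ (Q × S) ≃ α') (eQ : (P × S) ⊕ (Q × R) ≃ β') :
    ((((UForm.relabel _ _ _ _ eP eQ (toBig P Q R S (UForm.kV P Q (a, b), 1)) : UForm α' β') : GL (α' ⊕ β') ℂ) :
        Matrix (α' ⊕ β') (α' ⊕ β') ℂ)).toBlocks₁₂ = 0 := by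
  ext i j
  rw [UForm.coe_relabel, Matrix.toBlocks₁₂, Matrix.of_apply, Matrix.reindex_apply, Matrix.submatrix_apply, Equiv.sumCongr_symm,
    Equiv.sumCongr_apply, Equiv.sumCongr_apply, Sum.map_inl, Sum.map_inr, toBig_kV_one_apply_inl_inr, Matrix.zero_apply]

/-- the relabelled junction image has vanishing `₂₁` block. [cite: KonnoKonno2007, §3.1 (3.1)] -/
theorem toBlocks₂₁_relabel_toBig_kV_one (a : Matrix.unitaryGroup P ℂ) (b : Matrix.unitaryGroup Q ℂ)
    (eP : (P × R) ⊕ (Q × S) ≃ α') (eQ : (P × S) ⊕ (Q × R) ≃ β') :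
    ((((UForm.relabel _ _ _ _ eP eQ (toBig P Q R S (UForm.kV P Q (a, b), 1)) : UForm α' β') : GL (α' ⊕ β') ℂ) :
        Matrix (α' ⊕ β') (α' ⊕ β') ℂ)).toBlocks₂₁ = 0 := by
  ext i j
  rw [UForm.coe_relabel, Matrix.toBlocks₂₁, Matrix.of_apply, Matrix.reindex_apply, Matrix.submatrix_apply, Equiv.sumCongr_symm,
    Equiv.sumCongr_apply, Equiv.sumCongr_apply, Sum.map_inl, Sum.map_inr, toBig_kV_one_apply_inr_inl, Matrix.zero_apply]

/-- the `₂₂` block of the relabelled junction image is `diag(a ⊗ 1_S, b ⊗ 1_R)` relabelled by `eQ`. [cite: KonnoKonno2007, Lemma 5.2] -/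
theorem toBlocks₂₂_relabel_toBig_kV_one (a : Matrix.unitaryGroup P ℂ) (b : Matrix.unitaryGroup Q ℂ)
    (eP : (P × R) ⊕ (Q × S) ≃ α') (eQ : (P × S) ⊕ (Q × R) ≃ β') :
    ((((UForm.relabel _ _ _ _ eP eQ (toBig P Q R S (UForm.kV P Q (a, b), 1)) : UForm α' β') : GL (α' ⊕ β') ℂ) :
        Matrix (α' ⊕ β') (α' ⊕ β') ℂ)).toBlocks₂₂ =
      Matrix.reindex eQ eQ (Matrix.fromBlocks ((a : Matrix P P ℂ) ⊗ₖ (1 : Matrix S S ℂ)) 0 0 ((b : Matrix Q Q ℂ) ⊗ₖ (1 : Matrix R R ℂ))) := by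
  ext i j
  rw [UForm.coe_relabel, Matrix.toBlocks₂₂, Matrix.of_apply, Matrix.reindex_apply, Matrix.submatrix_apply, Equiv.sumCongr_symm,
    Equiv.sumCongr_apply, Equiv.sumCongr_apply, Sum.map_inr, Sum.map_inr, toBig_kV_one_apply_inr_inr, Matrix.reindex_apply,
    Matrix.submatrix_apply]

/-- the `₁₁` block of the relabelled junction image is `diag(a ⊗ 1_R, b ⊗ 1_S)` relabelled by `eP`. [cite: KonnoKonno2007, Lemma 5.2] -/
theorem toBlocks₁₁_relabel_toBig_kV_one (a : Matrix.unitaryGroup P ℂ) (b : Matrix.unitaryGroup Q ℂ)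
    (eP : (P × R) ⊕ (Q × S) ≃ α') (eQ : (P × S) ⊕ (Q × R) ≃ β') :
    ((((UForm.relabel _ _ _ _ eP eQ (toBig P Q R S (UForm.kV P Q (a, b), 1)) : UForm α' β') : GL (α' ⊕ β') ℂ) :
        Matrix (α' ⊕ β') (α' ⊕ β') ℂ)).toBlocks₁₁ =
      Matrix.reindex eP eP (Matrix.fromBlocks ((a : Matrix P P ℂ) ⊗ₖ (1 : Matrix R R ℂ)) 0 0 ((b : Matrix Q Q ℂ) ⊗ₖ (1 : Matrix S S ℂ))) := by
  ext i j
  rw [UForm.coe_relabel, Matrix.toBlocks₁₁, Matrix.of_apply, Matrix.reindex_apply, Matrix.submatrix_apply, Equiv.sumCongr_symm,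
    Equiv.sumCongr_apply, Equiv.sumCongr_apply, Sum.map_inl, Sum.map_inl, toBig_kV_one_apply_inl_inl, Matrix.reindex_apply,
    Matrix.submatrix_apply]

/-- **`det` OF THE MIXED-SIGN BLOCK: `det(a)^{|S|} · det(b)^{|R|}`.** [cite: KonnoKonno2007, Lemma 5.2] -/
theorem det_toBlocks₂₂_relabel_toBig_kV_one (a : Matrix.unitaryGroup P ℂ) (b : Matrix.unitaryGroup Q ℂ)
    (eP : (P × R) ⊕ (Q × S) ≃ α') (eQ : (P × S) ⊕ (Q × R) ≃ β') :
    ((((UForm.relabel _ _ _ _ eP eQ (toBig P Q R S (UForm.kV P Q (a, b), 1)) : UForm α' β') : GL (α' ⊕ β') ℂ) :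
        Matrix (α' ⊕ β') (α' ⊕ β') ℂ)).toBlocks₂₂.det =
      (a : Matrix P P ℂ).det ^ Fintype.card S * (b : Matrix Q Q ℂ).det ^ Fintype.card R := by
  rw [toBlocks₂₂_relabel_toBig_kV_one, Matrix.det_reindex_self, Matrix.det_fromBlocks_zero₂₁, Matrix.det_kronecker, Matrix.det_kronecker,
    Matrix.det_one, Matrix.det_one, one_pow, one_pow, mul_one, mul_one]

/-- **`det` OF THE SAME-SIGN BLOCK: `det(a)^{|R|} · det(b)^{|S|}`.** [cite: KonnoKonno2007, Lemma 5.2] -/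
theorem det_toBlocks₁₁_relabel_toBig_kV_one (a : Matrix.unitaryGroup P ℂ) (b : Matrix.unitaryGroup Q ℂ)
    (eP : (P × R) ⊕ (Q × S) ≃ α') (eQ : (P × S) ⊕ (Q × R) ≃ β') :
    ((((UForm.relabel _ _ _ _ eP eQ (toBig P Q R S (UForm.kV P Q (a, b), 1)) : UForm α' β') : GL (α' ⊕ β') ℂ) :
        Matrix (α' ⊕ β') (α' ⊕ β') ℂ)).toBlocks₁₁.det =
      (a : Matrix P P ℂ).det ^ Fintype.card R * (b : Matrix Q Q ℂ).det ^ Fintype.card S := by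
  rw [toBlocks₁₁_relabel_toBig_kV_one, Matrix.det_reindex_self, Matrix.det_fromBlocks_zero₂₁, Matrix.det_kronecker, Matrix.det_kronecker,
    Matrix.det_one, Matrix.det_one, one_pow, one_pow, mul_one, mul_one]

/-- **THE RELABELLED JUNCTION IMAGE OF `(kV (a,b), 1)` IS IN THE MAXIMAL COMPACT**, `= kV (A, B)`, with `det A = det(a)^{|R|}·det(b)^{|S|}` and
`det B = det(a)^{|S|}·det(b)^{|R|}` (★ `UForm.exists_eq_kV_of_toBlocks_eq_zero`). [cite: KonnoKonno2007, §3.1 (3.1), Lemma 5.2]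
[cite: Folland1989, §4.2 (4.39)] -/
theorem exists_kV_eq_relabel_toBig_kV_one (a : Matrix.unitaryGroup P ℂ) (b : Matrix.unitaryGroup Q ℂ)
    (eP : (P × R) ⊕ (Q × S) ≃ α') (eQ : (P × S) ⊕ (Q × R) ≃ β') :
    ∃ k : Matrix.unitaryGroup α' ℂ × Matrix.unitaryGroup β' ℂ,
      UForm.relabel _ _ _ _ eP eQ (toBig P Q R S (UForm.kV P Q (a, b), 1)) = UForm.kV α' β' k ∧
        (k.1 : Matrix α' α' ℂ).det = (a : Matrix P P ℂ).det ^ Fintype.card R * (b : Matrix Q Q ℂ).det ^ Fintype.card S ∧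
        (k.2 : Matrix β' β' ℂ).det = (a : Matrix P P ℂ).det ^ Fintype.card S * (b : Matrix Q Q ℂ).det ^ Fintype.card R := by
  obtain ⟨k, hk, h1, h2⟩ := UForm.exists_eq_kV_of_toBlocks_eq_zero (UForm.relabel _ _ _ _ eP eQ (toBig P Q R S (UForm.kV P Q (a, b), 1)))
    (toBlocks₁₂_relabel_toBig_kV_one a b eP eQ) (toBlocks₂₁_relabel_toBig_kV_one a b eP eQ)
  refine ⟨k, hk, ?_, ?_⟩
  · rw [h1, det_toBlocks₁₁_relabel_toBig_kV_one]
  · rw [h2, det_toBlocks₂₂_relabel_toBig_kV_one]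

end Summit.HodgeConjecture.HodgeConjecture.Cruxes.HLiu418.K2LiuJunctionCompactPairKType

end
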